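import Summits.QuantumFields.YangMills.Theorems.ColdStartUniversalityLatticeLangevinCoordCovariation
import Literature.Probability.Process.LevyCharacterisationVecModification
import HarnessLib

/-!
# Route `ColdStartUniversality` (and `TransportPerturbation`): a STOCHASTIC ROTATION of the flat driving
# noise of the SZZ dynamics is again a flat Brownian motion OF THE SAME FILTRATION

Helper file (seat `ym-line-csu-p1`, g13; `--supports stmt-QuantumFields-27872`).  The coupling lines of the
cold-start routes (LINE 10 «harris_hybrid» on `LyapunovContraction`, items 27872 `ClosePairContraction` /
27873 `RegularPairOverlap`; CSU `NeutralColdStartMixing` 27403/27404 with `R ≡ 1`) posit the object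
`UnitScaleMixedCoupling`: a second SZZ solution driven by the ROTATED noise `B' = B⊥ + ∫ R dB̄` with an adapted
orthogonal `R` (mirror before the merging time, identity after).  Its marginal lemma (L1) needs first of all that
`B'` is a flat Brownian motion of the COMMON filtration (blocked definition item `defn-UnitScaleMixedCoupling`,
literature-prover recommendation (ii): «an abstract 'rotated noise is flat BM' lemma … from
Process.levy_characterisation»).  This file provides exactly that, for the tree's flat noises
`W : ℝ≥0 → Ω → (Edge d L × κ → ℝ)` (`IsFlatBrownian W P`, raw natural filtration `hW.natFiltration`):

* ★ `exists_isFlatBrownian_stochasticRotation` — for every `hW.natFiltration`-progressive matrix process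
  `R_t(ω)` on `Edge d L × κ` with `R Rᵀ = 1` there are processes `W'` and `W̃` with
  `W'ᵃ = Σ_b ∫ R_{ab} dW^b` (Itô integrals `IsItoIntegral` w.r.t. `hW.natFiltration`), every `W'ᵃ` an
  `hW.natFiltration`-martingale with brackets `W'ᵃ W'ᵇ - δ_{ab} t` martingales, the shifted process `u ↦ W'_{s+u} - W'_s` INDEPENDENT of `hW.natFiltration s`
  (the Markov property w.r.t. the ORIGINAL noise's filtration), `W̃ = W'` at all times a.s., and
  `IsFlatBrownian W̃ P`.

It is the reindexing (`Fintype.equivFin`) of the Literature theorems `exists_isBrownianVec_orthogonalIntegral`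
(`LevyCharacterisationVecModification.lean`: covariation of Itô integrals + the VECTOR Lévy characterisation
`LevyCharacterisationVec*.lean`) along the flat coordinate martingale facts of this route
(`martingale_flatCoord`, `martingale_flatCoord_sq_sub`, `martingale_flatCoord_mul_flatCoord`, …).
THEOREMS ONLY, no sorry, standard axioms.  HONEST FRAMING: measure-theoretic plumbing for coupling
constructions; no contraction / overlap estimate (27872/27873) and nothing uniform in the cut-off is proved; no
crux, rung R3 or summit is proved; the Yang–Mills mass gap is NOT proved.
-/

set_option autoImplicit false

noncomputable section

namespace Summit.QuantumFields.YangMills.Theorems.ColdStartUniversality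

open MeasureTheory ProbabilityTheory Filter
open scoped NNReal ENNReal
open Literature.Probability.Process Literature.MathematicalPhysics.QuantumFieldTheory

variable {Ω : Type*} {mΩ : MeasurableSpace Ω} {P : Measure Ω} {d L : ℕ} [NeZero L] {κ : Type*}
  [Fintype κ] [DecidableEq κ] {W : ℝ≥0 → Ω → (Edge d L × κ → ℝ)}

/-- The coordinates of a flat Brownian motion have brackets `⟨W^a, W^b⟩_t = δ_{ab} t` for the joint raw
natural filtration: `W^a W^b - δ_{ab} t` is a martingale (diagonal: `martingale_flatCoord_sq_sub`; off-diagonal: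
`martingale_flatCoord_mul_flatCoord`). [folklore] -/
theorem martingale_flatCoord_mul_sub_ite [IsProbabilityMeasure P] (hW : IsFlatBrownian W P)
    (a b : Edge d L × κ) :
    Martingale (fun t ω => W t ω a * W t ω b - if a = b then (t : ℝ) else 0) hW.natFiltration P := by
  by_cases hab : a = b
  · subst hab
    simp only [if_true]
    have heq : (fun t ω => W t ω a * W t ω a - (t : ℝ)) = fun t ω => W t ω a ^ 2 - (t : ℝ) := by
      funext t ω; ring
    rw [heq]
    exact martingale_flatCoord_sq_sub hW a
  · simp only [hab, if_false, sub_zero]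
    exact martingale_flatCoord_mul_flatCoord hW hab

/-- ★ **A stochastic rotation of the flat driving noise is a flat Brownian motion of the same filtration.**
For a flat Brownian motion `W` (index set `Edge d L × κ`) and an `hW.natFiltration`-progressive matrix process
`R` with `R Rᵀ = 1`, the rotated noise `W'ᵃ = Σ_b ∫ R_{ab} dW^b` has coordinates which are
`hW.natFiltration`-martingales with `W'ᵃW'ᵇ - δ_{ab} t` martingales, its shifted process after any time `s` is independent of `hW.natFiltration s`,
and it has a modification `W̃` which is a flat Brownian motion, `IsFlatBrownian W̃ P`.
[cite: RevuzYor1999, Ch. IV Thm (3.6)] -/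
theorem exists_isFlatBrownian_stochasticRotation [IsProbabilityMeasure P] (hW : IsFlatBrownian W P)
    (R : ℝ≥0 → Ω → Matrix (Edge d L × κ) (Edge d L × κ) ℝ)
    (hR : ∀ a b, IsStronglyProgressive hW.natFiltration (fun t ω => R t ω a b))
    (hRO : ∀ t ω, R t ω * (R t ω).transpose = 1) :
    ∃ W' Wt : ℝ≥0 → Ω → (Edge d L × κ → ℝ),
      (∃ J : (Edge d L × κ) → (Edge d L × κ) → ℝ≥0 → Ω → ℝ,
        (∀ a b, IsItoIntegral (fun t ω => R t ω a b) (fun t ω => W t ω b) (J a b) hW.natFiltration P) ∧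
        ∀ t ω a, W' t ω a = ∑ b, J a b t ω) ∧
      (∀ a, Martingale (fun t ω => W' t ω a) hW.natFiltration P) ∧
      (∀ a b, Martingale (fun t ω => W' t ω a * W' t ω b - if a = b then (t : ℝ) else 0) hW.natFiltration P) ∧
      (∀ s, Indep (MeasurableSpace.comap (fun ω (u : ℝ≥0) => W' (s + u) ω - W' s ω) inferInstance)
        (hW.natFiltration s) P) ∧
      IsFlatBrownian Wt P ∧ ∀ᵐ ω ∂P, ∀ t, Wt t ω = W' t ω := by
  classical
  -- enumerate the index set
  set e := Fintype.equivFin (Edge d L × κ) with he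
  -- the enumerated noise and rotation
  have hBm : ∀ j, Martingale (fun t ω => W t ω (e.symm j)) hW.natFiltration P := fun j =>
    martingale_flatCoord hW (e.symm j)
  have hBB : ∀ j l, Martingale (fun t ω => W t ω (e.symm j) * W t ω (e.symm l) - if j = l then (t : ℝ) else 0)
      hW.natFiltration P := by
    intro j l
    have h := martingale_flatCoord_mul_sub_ite hW (e.symm j) (e.symm l)
    simp only [e.symm.injective.eq_iff] at h
    exact h
  have hB2 : ∀ t j, MemLp (fun ω => W t ω (e.symm j)) 2 P := fun t j => memLp_two_flatCoord hW t (e.symm j)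
  have hBc : ∀ j ω, Continuous fun t => W t ω (e.symm j) := fun j ω => continuous_flatCoord hW (e.symm j) ω
  have hR' : ∀ i j, IsStronglyProgressive hW.natFiltration
      (fun t ω => (R t ω).submatrix e.symm e.symm i j) := fun i j => by
    simp only [Matrix.submatrix_apply]
    exact hR (e.symm i) (e.symm j)
  have hRO' : ∀ t ω, (R t ω).submatrix e.symm e.symm * ((R t ω).submatrix e.symm e.symm).transpose = 1 := by
    intro t ω
    rw [Matrix.transpose_submatrix, Matrix.submatrix_mul_equiv, hRO t ω, Matrix.submatrix_one_equiv]
  obtain ⟨B', Wf, ⟨J, hJ, hB'J⟩, hM, hMM, hind, -, hWf, hae⟩ :=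
    exists_isBrownianVec_orthogonalIntegral hBm hBB hB2 hBc hR' hRO'
  refine ⟨fun t ω a => B' t ω (e a), fun t ω a => Wf t ω (e a),
    ⟨fun a b => J (e a) (e b), fun a b => ?_, fun t ω a => ?_⟩, fun a => hM (e a), fun a b => ?_, fun s => ?_, ?_, ?_⟩
  · -- the Itô integrals, reindexed
    have h := hJ (e a) (e b)
    simp only [Matrix.submatrix_apply, Equiv.symm_apply_apply] at h
    exact h
  · -- the row sums, reindexed
    show B' t ω (e a) = ∑ b, J (e a) (e b) t ω
    rw [hB'J t ω (e a)]
    exact (e.sum_comp (fun j => J (e a) j t ω)).symm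
  · -- the brackets, reindexed
    have h := hMM (e a) (e b)
    simp only [e.injective.eq_iff] at h
    exact h
  · -- independence of the shifted process from the original filtration
    refine indep_of_indep_of_le_left (hind s) ?_
    have hcomp : (fun ω (u : ℝ≥0) => (fun a => B' (s + u) ω (e a) - B' s ω (e a))) =
        (fun (f : ℝ≥0 → Fin (Fintype.card (Edge d L × κ)) → ℝ) (u : ℝ≥0) (a : Edge d L × κ) => f u (e a)) ∘
          vecShift B' s := by
      funext ω u a
      simp only [Function.comp_apply, vecShift, Pi.sub_apply]
    change MeasurableSpace.comap (fun ω (u : ℝ≥0) => (fun a => B' (s + u) ω (e a) - B' s ω (e a))) _ ≤ _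
    rw [hcomp, ← MeasurableSpace.comap_comp]
    refine MeasurableSpace.comap_mono (Measurable.comap_le ?_)
    exact measurable_pi_lambda _ fun u => measurable_pi_lambda _ fun a =>
      (measurable_pi_apply (e a)).comp (measurable_pi_apply u)
  · -- flatness of the modification
    change IsBrownianVec (fun t ω k => Wf t ω (e (e.symm k))) P
    simp only [Equiv.apply_symm_apply]
    exact hWf
  · filter_upwards [hae] with ω hω t
    funext a
    rw [hω t]

end Summit.QuantumFields.YangMills.Theorems.ColdStartUniversality

end
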